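import Mathlib

/-!
# The Paley difference-set count: `#{s ≠ 0 square : k - s non-square} = (q-3)/4`

Support file for item stmt-MatrixMultiplication-14308 (route `FourierTwoFamiliesModP`, decl
`PrimeTwoFamilies`, line Sketch, c4 "Paley capacity minus one").

For a prime `q ≡ 3 (mod 4)` the non-zero squares `S` of `ZMod q` form a
`(q, (q-1)/2, (q-3)/4)` difference set (Paley 1933; Baumert, *Cyclic Difference Sets* (1971),
Theorem 5.15: "the quadratic residues modulo a prime `v = 4t - 1` form a difference set with
parameters `4t-1, 2t-1, t-1`").  The lead file needs it in the following form: for every `k ≠ 0`,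
the number `c_k` of non-zero squares `s` with `k - s` a NON-square is `(q-3)/4 = q/4` (this is
the coefficient identity behind the Gauss-period product `η_S · η_N = (q+1)/4`).

Proof (quadratic character `χ = quadraticChar (ZMod q)`, values in `ℤ`).  Pointwise,
`(1 + χ s)(1 - χ (k - s)) = 4·[s counted] + [s = 0]·(1 - χ k) + [s = k]·(1 + χ k)`, so summing
over `s`, `4 c_k + 2 = Σ_s (1 + χ s)(1 - χ (k - s)) = q + Σ χ s - Σ χ (k - s) - Σ χ s χ (k - s)`
`= q - J` with `J = Σ_s χ s χ (k - s) = χ(k)² · jacobiSum χ χ = -χ(-1) = 1`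
(`jacobiSum_nontrivial_inv`; `-1` is a non-square as `q ≡ 3 (mod 4)`).  Hence `4 c_k = q - 3`.

No definitions; Mathlib only.
-/

-- the summit path `Summits/MatrixMultiplication/MatrixMultiplication/…` forces the repeated
-- namespace segment
set_option linter.dupNamespace false

namespace Summit.MatrixMultiplication.MatrixMultiplication.Theorems.PrimeTwoFamilies.PaleyRankBound

open Finset

/-- For a prime `q ≡ 3 (mod 4)`, `-1` is a non-square of `ZMod q`, i.e. `χ(-1) = -1`. -/
private theorem quadraticChar_neg_one_of_mod_four_eq_three {q : ℕ} [Fact q.Prime]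
    (hq3 : q % 4 = 3) : quadraticChar (ZMod q) (-1) = -1 :=
  quadraticChar_neg_one_iff_not_isSquare.mpr fun h => ZMod.exists_sq_eq_neg_one_iff.mp h hq3

/-- The shifted Jacobi sum of the quadratic character: `Σ_s χ(s) χ(k - s) = 1` for `k ≠ 0` and
a prime `q ≡ 3 (mod 4)` (substitute `s = k t` to get `χ(k)² · J(χ, χ) = -χ(-1) = 1`). -/
private theorem sum_quadraticChar_mul_sub {q : ℕ} [Fact q.Prime] (hq3 : q % 4 = 3) (k : ZMod q)
    (hk : k ≠ 0) :
    ∑ s : ZMod q, quadraticChar (ZMod q) s * quadraticChar (ZMod q) (k - s) = 1 := by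
  set χ := quadraticChar (ZMod q)
  have hq2 : ringChar (ZMod q) ≠ 2 := by
    rw [ZMod.ringChar_zmod_n]
    omega
  have hχ : χ ≠ 1 := quadraticChar_ne_one hq2
  -- reindex `s = k * t`
  have h1 : ∑ t : ZMod q, χ (k * t) * χ (k - k * t) = ∑ s : ZMod q, χ s * χ (k - s) :=
    Fintype.sum_equiv (Equiv.mulLeft₀ k hk) _ _ fun _ => rfl
  have h2 : ∀ t : ZMod q, χ (k * t) * χ (k - k * t) = χ k ^ 2 * (χ t * χ (1 - t)) := by
    intro t
    rw [show k - k * t = k * (1 - t) by ring, map_mul, map_mul]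
    ring
  -- the Jacobi sum `J(χ, χ) = J(χ, χ⁻¹) = -χ(-1) = 1`
  have hJ : jacobiSum χ χ⁻¹ = -χ (-1) := jacobiSum_nontrivial_inv hχ
  rw [(quadraticChar_isQuadratic (ZMod q)).inv, jacobiSum,
    quadraticChar_neg_one_of_mod_four_eq_three hq3, neg_neg] at hJ
  have hk2 : χ k ^ 2 = 1 := quadraticChar_sq_one hk
  rw [← h1, Fintype.sum_congr _ _ h2, ← Finset.mul_sum, hk2, one_mul, hJ]

/-- **The Paley difference-set count** (Paley 1933; Baumert 1971, Thm 5.15, in shifted form).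
For a prime `q ≡ 3 (mod 4)` and `k ≠ 0` in `ZMod q`, the number of non-zero squares `s` such
that `k - s` is a non-square equals `(q - 3)/4 = q/4`; in particular it does not depend on `k`
(the non-zero squares form a `(q, (q-1)/2, (q-3)/4)` difference set, equivalently the Paley
tournament is doubly regular).  Proof by the quadratic character:
`4·count + 2 = Σ_s (1 + χ s)(1 - χ (k - s)) = q - Σ_s χ s χ (k - s) = q - 1`. -/
theorem paley_shiftCount {q : ℕ} [Fact q.Prime] (hq3 : q % 4 = 3) (k : ZMod q) (hk : k ≠ 0) :
    (Finset.univ.filter fun s : ZMod q => s ≠ 0 ∧ IsSquare s ∧ ¬ IsSquare (k - s)).card = q / 4 := by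
  set χ := quadraticChar (ZMod q)
  have hq2 : ringChar (ZMod q) ≠ 2 := by
    rw [ZMod.ringChar_zmod_n]
    omega
  -- pointwise identity
  have hpt : ∀ s : ZMod q, (1 + χ s) * (1 - χ (k - s)) =
      4 * (if s ≠ 0 ∧ IsSquare s ∧ ¬ IsSquare (k - s) then 1 else 0) +
        ((if s = 0 then 1 - χ k else 0) + (if s = k then 1 + χ k else 0)) := by
    intro s
    by_cases hs0 : s = 0
    · have hk0 : ¬ (0 : ZMod q) = k := fun h => hk h.symm
      have hP : ¬ (s ≠ 0 ∧ IsSquare s ∧ ¬ IsSquare (k - s)) := fun h => h.1 hs0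
      rw [if_neg hP, if_pos hs0, hs0, if_neg hk0, MulChar.map_zero, sub_zero]
      ring
    by_cases hsk : s = k
    · have hP : ¬ (s ≠ 0 ∧ IsSquare s ∧ ¬ IsSquare (k - s)) := fun h =>
        h.2.2 (by rw [hsk, sub_self]; exact IsSquare.zero)
      rw [if_neg hP, if_neg hs0, if_pos hsk, hsk, sub_self, MulChar.map_zero]
      ring
    have hks : k - s ≠ 0 := sub_ne_zero.mpr (Ne.symm hsk)
    have e1 : IsSquare s ↔ χ s = 1 := (quadraticChar_one_iff_isSquare hs0).symm
    have e2 : ¬ IsSquare (k - s) ↔ χ (k - s) = -1 := quadraticChar_neg_one_iff_not_isSquare.symm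
    have d1 : χ s = 1 ∨ χ s = -1 := quadraticChar_dichotomy hs0
    have d2 : χ (k - s) = 1 ∨ χ (k - s) = -1 := quadraticChar_dichotomy hks
    simp only [e1, e2, if_neg hs0, if_neg hsk, add_zero]
    rcases d1 with h1 | h1 <;> rcases d2 with h2 | h2 <;> simp [h1, h2, hs0]
  -- sum it over `s`
  have hcard : (((Finset.univ.filter
      fun s : ZMod q => s ≠ 0 ∧ IsSquare s ∧ ¬ IsSquare (k - s)).card : ℕ) : ℤ) =
      ∑ s : ZMod q, (if s ≠ 0 ∧ IsSquare s ∧ ¬ IsSquare (k - s) then (1 : ℤ) else 0) :=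
    Finset.natCast_card_filter _ _
  have hsum : ∑ s : ZMod q, (1 + χ s) * (1 - χ (k - s)) =
      4 * (∑ s : ZMod q, (if s ≠ 0 ∧ IsSquare s ∧ ¬ IsSquare (k - s) then (1 : ℤ) else 0))
        + 2 := by
    rw [Finset.sum_congr rfl fun s _ => hpt s, Finset.sum_add_distrib, Finset.sum_add_distrib,
      ← Finset.mul_sum, Fintype.sum_ite_eq', Fintype.sum_ite_eq']
    ring
  -- evaluate the character sums
  have hone : ∑ _s : ZMod q, (1 : ℤ) = q := by
    rw [Finset.sum_const, Finset.card_univ, ZMod.card, nsmul_eq_mul, mul_one]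
  have hχ0 : ∑ s : ZMod q, χ s = 0 := quadraticChar_sum_zero hq2
  have hχk : ∑ s : ZMod q, χ (k - s) = 0 := by
    rw [← hχ0]
    exact Equiv.sum_comp (Equiv.subLeft k) χ
  have hJ : ∑ s : ZMod q, χ s * χ (k - s) = 1 := sum_quadraticChar_mul_sub hq3 k hk
  have hexp : ∀ s : ZMod q,
      (1 + χ s) * (1 - χ (k - s)) = 1 + χ s - χ (k - s) - χ s * χ (k - s) := fun s => by ring
  have htot : ∑ s : ZMod q, (1 + χ s) * (1 - χ (k - s)) = (q : ℤ) - 1 := by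
    rw [Fintype.sum_congr _ _ hexp, Finset.sum_sub_distrib, Finset.sum_sub_distrib,
      Finset.sum_add_distrib, hone, hχ0, hχk, hJ]
    ring
  omega

end Summit.MatrixMultiplication.MatrixMultiplication.Theorems.PrimeTwoFamilies.PaleyRankBound
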